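import Literature.Analysis.OperatorTheory.PositiveKernelTransferOperator
import Literature.Analysis.OperatorTheory.PositivityImprovingSpectralGap
import HarnessLib

/-!
# A pointwise, everywhere positive, bounded eigenfunction of a strictly positive symmetric kernel
# (Jentzsch's theorem, pointwise form) — PROVED

Topic `Literature/Analysis/OperatorTheory`; proofs-only companion of
`PositiveKernelTransferOperator.lean` (the transfer operator `(Aφ)(x) = ∫ K(x,y) φ(y) dμ(y)` of a
bounded, symmetric, strictly positive kernel on a finite measure space: compact, self-adjoint,
positivity improving) and `PositivityImprovingSpectralGap.lean` (Jentzsch / Kreĭn–Rutman: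
`IsPositivityImproving.exists_spectralGap`, a unit a.e. strictly positive `φ ∈ L²` with
`Aφ = ‖A‖ φ`).

For the construction of one-dimensional Gibbs states as stationary Markov chains one needs the
eigenfunction as an honest FUNCTION satisfying the eigen-equation at EVERY point (it enters
pointwise into transition densities). This file upgrades the `L²` statement:

* `exists_pointwise_eigenfunction` — there are `λ₀ > 0` and a measurable `h : X → ℝ` with
  `0 < h(x) ≤ B` for all `x`, `∫ K(x, y) h(y) dμ(y) = λ₀ h(x)` for ALL `x`, and `∫ h² dμ = 1`
  (take `h = λ₀⁻¹ ∫ K(·, y) φ(y) dμ(y)`, the everywhere-defined version of `φ`; `λ₀ = ‖A‖`);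
* `exists_pointwise_eigenfunction_lintegral` — the same packaged with lower Lebesgue integrals
  (`∫⁻ K h dμ = ofReal (λ₀ h x)`, `∫⁻ h² dμ = 1`), the form consumed by density computations.

Sources: Reed–Simon IV, §XIII.12, Thms XIII.43–44 (Jentzsch's theorem in the compact case)
[`ReedSimonIV1978`]; the pointwise version is the standard remark that `Aφ` is a genuine bounded
function when `K` is bounded. No definitions, no named facts.
-/

noncomputable section

open MeasureTheory Set Filter Function
open scoped RealInnerProductSpace ENNReal

namespace Literature.Analysis.OperatorTheory

variable {X : Type*} [MeasurableSpace X] {μ : Measure X} [IsFiniteMeasure μ]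
variable {K : X → X → ℝ} {C : ℝ}

/-- **Jentzsch's theorem, pointwise form.** For a bounded, jointly measurable, symmetric, strictly
positive kernel `K` on a nonzero finite measure space there are `λ₀ > 0` (the norm of the transfer
operator) and a measurable function `h` with `0 < h(x) ≤ B` everywhere,
`∫ K(x, y) h(y) dμ(y) = λ₀ h(x)` for EVERY `x`, and `∫ h² dμ = 1`.
[cite: ReedSimonIV1978, Thm XIII.43 and Thm XIII.44] -/
theorem exists_pointwise_eigenfunction (hK : StronglyMeasurable (uncurry K))
    (hC : ∀ x y, ‖K x y‖ ≤ C) (hsymm : ∀ x y, K x y = K y x) (hpos : ∀ x y, 0 < K x y)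
    (hμ : μ ≠ 0) :
    ∃ (lam : ℝ) (h : X → ℝ) (B : ℝ), 0 < lam ∧ Measurable h ∧ (∀ x, 0 < h x) ∧ (∀ x, h x ≤ B) ∧
      (∀ x, Integrable (fun y => K x y * h y) μ) ∧
      (∀ x, ∫ y, K x y * h y ∂μ = lam * h x) ∧
      Integrable (fun x => h x ^ 2) μ ∧ ∫ x, h x ^ 2 ∂μ = 1 := by
  obtain ⟨A, hA, hsa, hc, himp, h0⟩ := exists_transferOperator (μ := μ) hK hC hsymm hpos hμ
  obtain ⟨φ, hφ1, hφpos, hAφ, -, -⟩ := himp.exists_spectralGap hsa hc h0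
  have hlam : 0 < ‖A‖ := norm_pos_iff.2 h0
  have hC0 : 0 ≤ C := by
    have : μ univ ≠ 0 := fun h => hμ (Measure.measure_univ_eq_zero.1 h)
    obtain ⟨x, -⟩ := nonempty_of_measure_ne_zero this
    exact (norm_nonneg _).trans (hC x x)
  -- the everywhere-defined version of `φ`
  set g : X → ℝ := fun x => ∫ y, K x y * φ y ∂μ with hg
  set h : X → ℝ := fun x => ‖A‖⁻¹ * g x with hh
  have hint : ∀ x, Integrable (fun y => K x y * φ y) μ := fun x =>
    integrable_kernel_mul_coeFn (μ := μ) hK hC φ x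
  -- `h = φ` a.e.
  have hae : (φ : X → ℝ) =ᵐ[μ] h := by
    have h1 : ((‖A‖ • φ : Lp ℝ 2 μ) : X → ℝ) =ᵐ[μ] g := by
      rw [← hAφ]; exact hA φ
    filter_upwards [h1, Lp.coeFn_smul ‖A‖ φ] with x hx hs
    rw [hh]
    dsimp only
    rw [← hx, hs, Pi.smul_apply, smul_eq_mul, ← mul_assoc, inv_mul_cancel₀ hlam.ne', one_mul]
  have hgm : Measurable g := (stronglyMeasurable_integral_kernel_mul hK φ).measurable
  have hhm : Measurable h := hgm.const_mul _
  -- positivity everywhere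
  have hφ0 : 0 ≤ᵐ[μ] (φ : X → ℝ) := by
    filter_upwards [hφpos] with x hx using hx.le
  have hsupp : 0 < μ (support (φ : X → ℝ)) := by
    rw [pos_iff_ne_zero]
    intro hz
    have h1 : ∀ᵐ x ∂μ, x ∉ support (φ : X → ℝ) := measure_eq_zero_iff_ae_notMem.1 hz
    have h2 : ∀ᵐ x ∂μ, False := by
      filter_upwards [h1, hφpos] with x hx hx'
      exact hx (mem_support.2 hx'.ne')
    exact hμ (MeasureTheory.ae_eq_bot.1 (Filter.eventually_false_iff_eq_bot.1 h2))
  have hgpos : ∀ x, 0 < g x := by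
    intro x
    have hnn : 0 ≤ᵐ[μ] fun y => K x y * φ y := by
      filter_upwards [hφ0] with y hy using mul_nonneg (hpos x y).le hy
    rw [hg]
    dsimp only
    rw [integral_pos_iff_support_of_nonneg_ae hnn (hint x)]
    have hs : support (fun y => K x y * φ y) = support (φ : X → ℝ) := by
      ext y
      simp only [mem_support, ne_eq, mul_eq_zero, (hpos x y).ne', false_or]
    rwa [hs]
  have hhpos : ∀ x, 0 < h x := fun x => mul_pos (inv_pos.2 hlam) (hgpos x)
  -- the bound
  have hgle : ∀ x, g x ≤ C * Real.sqrt (μ.real univ) := fun x => by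
    have := abs_integral_kernel_mul_le (μ := μ) hC hC0 φ x
    rw [hφ1, mul_one] at this
    exact (le_abs_self _).trans this
  have hhle : ∀ x, h x ≤ ‖A‖⁻¹ * (C * Real.sqrt (μ.real univ)) := fun x =>
    mul_le_mul_of_nonneg_left (hgle x) (inv_pos.2 hlam).le
  -- the pointwise eigen-equation
  have hinth : ∀ x, Integrable (fun y => K x y * h y) μ := fun x =>
    (hint x).congr (by filter_upwards [hae] with y hy; rw [hy])
  have heig : ∀ x, ∫ y, K x y * h y ∂μ = ‖A‖ * h x := by
    intro x
    have h1 : ∫ y, K x y * h y ∂μ = g x := by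
      rw [hg]
      exact integral_congr_ae (by filter_upwards [hae] with y hy; rw [hy])
    rw [h1, hh]
    dsimp only
    rw [← mul_assoc, mul_inv_cancel₀ hlam.ne', one_mul]
  -- the normalisation
  have hsq_int : Integrable (fun x => (φ : X → ℝ) x ^ 2) μ := by
    have := L2.integrable_inner (𝕜 := ℝ) φ φ
    refine this.congr (Eventually.of_forall fun x => ?_)
    simp only [RCLike.inner_apply', conj_trivial]
    ring
  have hsq_int_h : Integrable (fun x => h x ^ 2) μ :=
    hsq_int.congr (by filter_upwards [hae] with x hx; rw [hx])
  have hnorm : ∫ x, h x ^ 2 ∂μ = 1 := by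
    have h1 : ∫ x, h x ^ 2 ∂μ = ∫ x, (φ : X → ℝ) x ^ 2 ∂μ :=
      integral_congr_ae (by filter_upwards [hae] with x hx; rw [hx])
    have h2 : ⟪φ, φ⟫ = ∫ x, (φ : X → ℝ) x ^ 2 ∂μ := by
      rw [L2.inner_def]
      refine integral_congr_ae (Eventually.of_forall fun x => ?_)
      simp only [RCLike.inner_apply', conj_trivial]
      ring
    rw [h1, ← h2, real_inner_self_eq_norm_sq, hφ1, one_pow]
  exact ⟨‖A‖, h, ‖A‖⁻¹ * (C * Real.sqrt (μ.real univ)), hlam, hhm, hhpos, hhle, hinth, heig,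
    hsq_int_h, hnorm⟩

/-- **Jentzsch's theorem, pointwise `lintegral` form.** Same data as
`exists_pointwise_eigenfunction`, with the eigen-equation and the normalisation written as lower
Lebesgue integrals of `ℝ≥0∞`-valued functions:
`∫⁻ ofReal (K x y) * ofReal (h y) dμ(y) = ofReal (λ₀ h x)` for every `x` and
`∫⁻ ofReal (h x)² dμ = 1`. [cite: ReedSimonIV1978, Thm XIII.43 and Thm XIII.44] -/
theorem exists_pointwise_eigenfunction_lintegral (hK : StronglyMeasurable (uncurry K))
    (hC : ∀ x y, ‖K x y‖ ≤ C) (hsymm : ∀ x y, K x y = K y x) (hpos : ∀ x y, 0 < K x y)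
    (hμ : μ ≠ 0) :
    ∃ (lam : ℝ) (h : X → ℝ) (B : ℝ), 0 < lam ∧ Measurable h ∧ (∀ x, 0 < h x) ∧ (∀ x, h x ≤ B) ∧
      (∀ x, ∫⁻ y, ENNReal.ofReal (K x y) * ENNReal.ofReal (h y) ∂μ =
        ENNReal.ofReal (lam * h x)) ∧
      ∫⁻ x, ENNReal.ofReal (h x) ^ 2 ∂μ = 1 := by
  obtain ⟨lam, h, B, hlam, hhm, hhpos, hhle, hint, heig, hsqi, hnorm⟩ :=
    exists_pointwise_eigenfunction (μ := μ) hK hC hsymm hpos hμ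
  refine ⟨lam, h, B, hlam, hhm, hhpos, hhle, fun x => ?_, ?_⟩
  · rw [← heig x, ofReal_integral_eq_lintegral_ofReal (hint x)
      (Eventually.of_forall fun y => mul_nonneg (hpos x y).le (hhpos y).le)]
    refine lintegral_congr fun y => ?_
    rw [ENNReal.ofReal_mul (hpos x y).le]
  · rw [← ENNReal.ofReal_one, ← hnorm, ofReal_integral_eq_lintegral_ofReal hsqi
      (Eventually.of_forall fun x => sq_nonneg (h x))]
    refine lintegral_congr fun x => ?_
    rw [ENNReal.ofReal_pow (hhpos x).le]

end Literature.Analysis.OperatorTheory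

end
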